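import Summits.CriticalPhenomena.SAWScalingLimit.Theses.SAWDefectDecoherence
import Summits.CriticalPhenomena.SAWScalingLimit.Theorems.SAWDefectDecoherencePickHalfPlaneDefs
import Summits.CriticalPhenomena.SAWScalingLimit.Theorems.SAWDefectDecoherenceBoundaryClosureRGateAnchor

/-!
# Developing maps: lattice steps of a potential (crux `BoundaryClosureR`,
stmt-CriticalPhenomena-14004, line `pick-half-plane`, stub `stub_developingMapsCompact`)

Support file (topic: the increments of a potential of `F dz` along the two axis directions of the
triangular lattice, and the resulting bound along an "up–across–up" lattice path).

For a potential `H` (`IsPotential Λ a H`) the increment across the `𝕋`-edge `(k,m) → (k+1,m)` is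
`(mid(floorEdge k m) − c(upFace k m))·F(floorEdge k m)` (`Gate.potential_floor_step`) and across
`(k,m) → (k,m+1)` it is
`−(mid − c(upFace k m))·F(upEdge)`, `upEdge = {upFace k m, (![k-1,m],1)}`, as soon as the up-face
`upFace k m` lies in `Λ`; both half-edge vectors have norm `≤ 1`.  Summing along a column, a row,
and the path `s ↑ (s₀,T) → (max,T) ← (s'₀,T) ↑ s'` (`T = max s₁ s'₁ + 1`) gives: the increment
`H s' − H s` does not depend on the potential, and `‖H s' − H s‖ ≤ (|Δ₀| + 2|Δ₁| + 2)·B` whenever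
the observable is bounded by `B` on the mid-edges of the box.  Pure lattice bookkeeping
(Duminil-Copin–Smirnov 2012, §4, the map `H` with `dH = F dz`).
-/

noncomputable section

open Literature.Probability.LatticeModels Literature.Probability.RandomPlanarGeometry
open Literature.Probability.RandomPlanarGeometry.SAW
open Summit.CriticalPhenomena.SAWScalingLimit.Theorems.PickHalfPlane.Gate (potential_floor_step)

namespace Summit.CriticalPhenomena.SAWScalingLimit.Theorems.PickHalfPlane.DevelopingMaps

/-! ### Coordinates -/

/-- Imaginary part of an embedded site: `m √3/2`. [folklore] -/
theorem im_triEmbed_vec2 (k m : ℤ) : (triEmbed ![k, m]).im = m * (Real.sqrt 3 / 2) := by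
  simp [triEmbed, triZeta_im]

/-- Real part of an embedded site: `k + m/2`. [folklore] -/
theorem re_triEmbed_vec2 (k m : ℤ) : (triEmbed ![k, m]).re = k + m * (1 / 2) := by
  simp [triEmbed, triZeta_re]

/-! ### The two axis steps of a potential -/

/-- The midpoint of the floor edge under the cell `(k, m)` is `triEmbed ![k,m] + 1/2`. [folklore] -/
theorem hexMidpoint_floorEdge (k m : ℤ) : hexMidpoint (floorEdge k m) = triEmbed ![k, m] + 1 / 2 := by
  unfold floorEdge belowFace upFace
  rw [hexMidpoint_mk]
  simp only [hexCenter, triEmbed, Matrix.cons_val_zero, Matrix.cons_val_one, Fin.val_one,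
    Fin.val_zero, Nat.cast_one, Nat.cast_zero, Int.cast_sub, Int.cast_one]
  ring

/-- The midpoint of the "up edge" `{upFace k m, (![k-1,m],1)}` (dual to the `𝕋`-edge
`(k,m) → (k,m+1)`) is `triEmbed ![k,m] + ζ/2`. [folklore] -/
theorem hexMidpoint_upEdge (k m : ℤ) :
    hexMidpoint s(upFace k m, ((![k - 1, m], 1) : HexVertex)) = triEmbed ![k, m] + triZeta / 2 := by
  unfold upFace
  rw [hexMidpoint_mk]
  simp only [hexCenter, triEmbed, Matrix.cons_val_zero, Matrix.cons_val_one, Fin.val_one,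
    Fin.val_zero, Nat.cast_one, Nat.cast_zero, Int.cast_sub, Int.cast_one]
  ring

/-- The floor half-edge vector has norm `≤ 1` (it is `(1 − 2ζ)/6`, of norm `1/(2√3)`). [folklore] -/
theorem norm_floor_halfEdge_le (k m : ℤ) :
    ‖hexMidpoint (floorEdge k m) - hexCenter (upFace k m)‖ ≤ 1 := by
  rw [hexMidpoint_floorEdge_sub, norm_div]
  have h : ‖(1 : ℂ) - 2 * triZeta‖ ≤ 3 := by
    calc ‖(1 : ℂ) - 2 * triZeta‖ ≤ ‖(1 : ℂ)‖ + ‖2 * triZeta‖ := norm_sub_le _ _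
      _ = 3 := by
        rw [norm_mul, norm_one, Complex.norm_two]
        have : ‖triZeta‖ = 1 := by
          rw [← Real.sqrt_sq (norm_nonneg _), ← Complex.normSq_eq_norm_sq, normSq_triZeta,
            Real.sqrt_one]
        rw [this]; norm_num
  have h6 : ‖(6 : ℂ)‖ = 6 := by simp
  rw [h6]
  linarith

/-- The up half-edge vector `mid(upEdge) − c(upFace k m) = (ζ − 2)/6` has norm `≤ 1`. [folklore] -/
theorem norm_up_halfEdge_le (k m : ℤ) :
    ‖hexMidpoint s(upFace k m, ((![k - 1, m], 1) : HexVertex)) - hexCenter (upFace k m)‖ ≤ 1 := by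
  rw [hexMidpoint_upEdge]
  have hc : hexCenter (upFace k m) = triEmbed ![k, m] + (1 + triZeta) / 3 := by
    unfold upFace; simp [hexCenter]
  rw [hc, show triEmbed ![k, m] + triZeta / 2 - (triEmbed ![k, m] + (1 + triZeta) / 3) =
    (triZeta - 2) / 6 by ring, norm_div]
  have h : ‖triZeta - 2‖ ≤ 3 := by
    calc ‖triZeta - 2‖ ≤ ‖triZeta‖ + ‖(2 : ℂ)‖ := norm_sub_le _ _
      _ = 3 := by
        rw [Complex.norm_two]
        have : ‖triZeta‖ = 1 := by
          rw [← Real.sqrt_sq (norm_nonneg _), ← Complex.normSq_eq_norm_sq, normSq_triZeta,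
            Real.sqrt_one]
        rw [this]; norm_num
  have h6 : ‖(6 : ℂ)‖ = 6 := by simp
  rw [h6]
  linarith

/-- The up-face `upFace k m` is adjacent to the down-face of the cell to its west. [folklore] -/
theorem adj_upFace_west (k m : ℤ) : hexGraph.Adj (upFace k m) ((![k - 1, m], 1) : HexVertex) := by
  unfold upFace
  rw [Literature.Probability.LatticeModels.hexGraph_adj_iff_of_snd_eq_zero_holds]
  exact Or.inr (Or.inl (by ext i; fin_cases i <;> simp [sub_eq_add_neg]))

/-- **The northward step** `(k, m) → (k, m+1)` of any potential is
`−(mid(upEdge) − c(upFace k m))·F(upEdge)`, `upEdge = {upFace k m, (![k-1,m],1)}`, as soon as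
`upFace k m ∈ Λ` (its centre lies to the RIGHT of the step, i.e. to the left of the reversed
step). [cite: DuminilCopinSmirnov2012, §4 (the map H with dH = F dz)] -/
theorem potential_step_north {Λ : Finset HexVertex} {a : Sym2 HexVertex} {H : Site 2 → ℂ}
    (hH : IsPotential Λ a H) {k m : ℤ} (hup : upFace k m ∈ Λ) :
    H ![k, m + 1] - H ![k, m] =
      -((hexMidpoint s(upFace k m, ((![k - 1, m], 1) : HexVertex)) - hexCenter (upFace k m)) *
        hexParafermionicObservable Λ a hexCriticalFugacity (5 / 8)
          s(upFace k m, ((![k - 1, m], 1) : HexVertex))) := by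
  have h1 : (![k, m + 1] : Site 2) = ![k, m] + Pi.single 1 1 := by ext i; fin_cases i <;> simp
  have hsv : (![k, m + 1] : Site 2) ∈ hexFaceVertices (upFace k m) := by
    unfold upFace; rw [mem_hexFaceVertices_zero, h1]; exact Or.inr (Or.inr rfl)
  have htv : (![k, m] : Site 2) ∈ hexFaceVertices (upFace k m) := by
    unfold upFace; rw [mem_hexFaceVertices_zero]; exact Or.inl rfl
  have hsw : (![k, m + 1] : Site 2) ∈ hexFaceVertices ((![k - 1, m], 1) : HexVertex) := by
    rw [mem_hexFaceVertices_one]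
    exact Or.inr (Or.inr (by ext i; fin_cases i <;> simp))
  have htw : (![k, m] : Site 2) ∈ hexFaceVertices ((![k - 1, m], 1) : HexVertex) := by
    rw [mem_hexFaceVertices_one]
    exact Or.inl (by ext i; fin_cases i <;> simp)
  have hne : (![k, m + 1] : Site 2) ≠ ![k, m] := fun h => by simpa using congrFun h 1
  have hor : 0 < ((starRingEnd ℂ) (triEmbed ![k, m] - triEmbed ![k, m + 1]) *
      (hexCenter (upFace k m) - triEmbed ![k, m + 1])).im := by
    rw [h1, triEmbed_add, triEmbed_single_one]
    unfold upFace
    simp only [hexCenter, Fin.val_zero, Nat.cast_zero, zero_add, one_mul]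
    have h3 : Real.sqrt 3 * Real.sqrt 3 = 3 := Real.mul_self_sqrt (by norm_num)
    have hs : (0 : ℝ) < Real.sqrt 3 := Real.sqrt_pos.2 (by norm_num)
    simp [Complex.mul_im, triZeta_im, triZeta_re]
    nlinarith [h3, hs]
  have key := hH (upFace k m) hup ((![k - 1, m], 1) : HexVertex) (adj_upFace_west k m)
    ![k, m + 1] ![k, m] hsv htv hsw htw hne hor
  have : H ![k, m + 1] - H ![k, m] = -(H ![k, m] - H ![k, m + 1]) := by ring
  rw [this, key]

/-! ### Columns and rows -/

/-- **A column of northward steps.**  If the up-faces `upFace k (m + l)`, `l < n`, lie in `Λ` and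
the observable is bounded by `B` on the corresponding up-edges, then the increment of a
potential from `(k, m)` to `(k, m + n)` does not depend on the potential and has norm `≤ n·B`.
[folklore] -/
theorem column_link {Λ : Finset HexVertex} {a : Sym2 HexVertex} (k m : ℤ) (n : ℕ) {B : ℝ}
    (h : ∀ l : ℕ, l < n → upFace k (m + l) ∈ Λ ∧
      ‖hexParafermionicObservable Λ a hexCriticalFugacity (5 / 8)
        s(upFace k (m + l), ((![k - 1, m + l], 1) : HexVertex))‖ ≤ B) :
    (∀ H H' : Site 2 → ℂ, IsPotential Λ a H → IsPotential Λ a H' →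
      H ![k, m + n] - H ![k, m] = H' ![k, m + n] - H' ![k, m]) ∧
    (∀ H : Site 2 → ℂ, IsPotential Λ a H → ‖H ![k, m + n] - H ![k, m]‖ ≤ n * B) := by
  induction n with
  | zero =>
    refine ⟨fun H H' _ _ => by simp, fun H _ => by simp⟩
  | succ n ih =>
    have ih' := ih fun l hl => h l (Nat.lt_succ_of_lt hl)
    obtain ⟨hup, hFB⟩ := h n (Nat.lt_succ_self n)
    have hcast : (m + ((n + 1 : ℕ) : ℤ)) = m + (n : ℤ) + 1 := by push_cast; ring
    refine ⟨fun H H' hH hH' => ?_, fun H hH => ?_⟩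
    · have e1 := potential_step_north hH hup
      have e2 := potential_step_north hH' hup
      have e3 := ih'.1 H H' hH hH'
      rw [hcast]
      linear_combination e1 - e2 + e3
    · have e1 := potential_step_north hH hup
      have e3 := ih'.2 H hH
      rw [hcast]
      have hstep : ‖H ![k, m + ↑n + 1] - H ![k, m + ↑n]‖ ≤ B := by
        rw [e1, norm_neg, norm_mul]
        calc _ ≤ 1 * B := mul_le_mul (norm_up_halfEdge_le _ _) hFB (norm_nonneg _) zero_le_one
          _ = B := one_mul B
      calc ‖H ![k, m + ↑n + 1] - H ![k, m]‖
          = ‖(H ![k, m + ↑n + 1] - H ![k, m + ↑n]) + (H ![k, m + ↑n] - H ![k, m])‖ := by ring_nf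
        _ ≤ ‖H ![k, m + ↑n + 1] - H ![k, m + ↑n]‖ + ‖H ![k, m + ↑n] - H ![k, m]‖ := norm_add_le _ _
        _ ≤ B + n * B := add_le_add hstep e3
        _ = ((n + 1 : ℕ) : ℝ) * B := by push_cast; ring

/-- **A row of eastward steps.**  If the up-faces `upFace (k + l) m`, `l < n`, lie in `Λ` and the
observable is bounded by `B` on the floor edges under them, then the increment of a potential
from `(k, m)` to `(k + n, m)` does not depend on the potential and has norm `≤ n·B`. [folklore] -/
theorem row_link {Λ : Finset HexVertex} {a : Sym2 HexVertex} (k m : ℤ) (n : ℕ) {B : ℝ}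
    (h : ∀ l : ℕ, l < n → upFace (k + l) m ∈ Λ ∧
      ‖hexParafermionicObservable Λ a hexCriticalFugacity (5 / 8) (floorEdge (k + l) m)‖ ≤ B) :
    (∀ H H' : Site 2 → ℂ, IsPotential Λ a H → IsPotential Λ a H' →
      H ![k + n, m] - H ![k, m] = H' ![k + n, m] - H' ![k, m]) ∧
    (∀ H : Site 2 → ℂ, IsPotential Λ a H → ‖H ![k + n, m] - H ![k, m]‖ ≤ n * B) := by
  induction n with
  | zero =>
    refine ⟨fun H H' _ _ => by simp, fun H _ => by simp⟩
  | succ n ih =>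
    have ih' := ih fun l hl => h l (Nat.lt_succ_of_lt hl)
    obtain ⟨hup, hFB⟩ := h n (Nat.lt_succ_self n)
    have hcast : (k + ((n + 1 : ℕ) : ℤ)) = k + (n : ℤ) + 1 := by push_cast; ring
    refine ⟨fun H H' hH hH' => ?_, fun H hH => ?_⟩
    · have e1 := potential_floor_step hH hup
      have e2 := potential_floor_step hH' hup
      have e3 := ih'.1 H H' hH hH'
      rw [hcast]
      linear_combination e1 - e2 + e3
    · have e1 := potential_floor_step hH hup
      have e3 := ih'.2 H hH
      rw [hcast]
      have hstep : ‖H ![k + ↑n + 1, m] - H ![k + ↑n, m]‖ ≤ B := by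
        rw [e1, norm_mul]
        calc _ ≤ 1 * B := mul_le_mul (norm_floor_halfEdge_le _ _) hFB (norm_nonneg _) zero_le_one
          _ = B := one_mul B
      calc ‖H ![k + ↑n + 1, m] - H ![k, m]‖
          = ‖(H ![k + ↑n + 1, m] - H ![k + ↑n, m]) + (H ![k + ↑n, m] - H ![k, m])‖ := by ring_nf
        _ ≤ ‖H ![k + ↑n + 1, m] - H ![k + ↑n, m]‖ + ‖H ![k + ↑n, m] - H ![k, m]‖ := norm_add_le _ _
        _ ≤ B + n * B := add_le_add hstep e3
        _ = ((n + 1 : ℕ) : ℝ) * B := by push_cast; ring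

/-! ### The up–across–up path -/

/-- **The box link.**  For two sites `s = ![i, j]`, `s' = ![i', j']` let `T = max j j' + 1`.  If the
up-faces of the two columns `i`, `i'` between the rows `min j j'` and `max j j'` and of the row `T`
between the columns lie in `Λ`, and the observable is bounded by `B ≥ 0` on the corresponding
up-edges and floor edges, then along the lattice path `s ↑ (i,T) → (max i i', T) ← (i',T) ↑ s'`
the increment `H s' − H s` of a potential does not depend on the potential and
`‖H s' − H s‖ ≤ (|i' − i| + 2|j' − j| + 2)·B`. [folklore] -/
theorem box_link {Λ : Finset HexVertex} {a : Sym2 HexVertex} (i j i' j' : ℤ) {B : ℝ} (hB : 0 ≤ B)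
    (hcol : ∀ k l : ℤ, (k = i ∨ k = i') → min j j' ≤ l → l ≤ max j j' → upFace k l ∈ Λ ∧
      ‖hexParafermionicObservable Λ a hexCriticalFugacity (5 / 8)
        s(upFace k l, ((![k - 1, l], 1) : HexVertex))‖ ≤ B)
    (hrow : ∀ k : ℤ, min i i' ≤ k → k < max i i' → upFace k (max j j' + 1) ∈ Λ ∧
      ‖hexParafermionicObservable Λ a hexCriticalFugacity (5 / 8) (floorEdge k (max j j' + 1))‖ ≤ B) :
    (∀ H H' : Site 2 → ℂ, IsPotential Λ a H → IsPotential Λ a H' →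
      H ![i', j'] - H ![i, j] = H' ![i', j'] - H' ![i, j]) ∧
    (∀ H : Site 2 → ℂ, IsPotential Λ a H →
      ‖H ![i', j'] - H ![i, j]‖ ≤ (|i' - i| + 2 * |j' - j| + 2) * B) := by
  set T : ℤ := max j j' + 1 with hT
  set n : ℕ := (T - j).toNat with hn
  set n' : ℕ := (T - j').toNat with hn'
  set p : ℕ := (max i i' - i).toNat with hp
  set p' : ℕ := (max i i' - i').toNat with hp'
  have hnz : (n : ℤ) = T - j := Int.toNat_of_nonneg (by rw [hT]; omega)
  have hnz' : (n' : ℤ) = T - j' := Int.toNat_of_nonneg (by rw [hT]; omega)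
  have hpz : (p : ℤ) = max i i' - i := Int.toNat_of_nonneg (by omega)
  have hpz' : (p' : ℤ) = max i i' - i' := Int.toNat_of_nonneg (by omega)
  -- the four segments
  have c1 := column_link (Λ := Λ) (a := a) i j n fun l hl =>
    hcol i (j + l) (Or.inl rfl) (by omega) (by omega)
  have c2 := column_link (Λ := Λ) (a := a) i' j' n' fun l hl =>
    hcol i' (j' + l) (Or.inr rfl) (by omega) (by omega)
  have r1 := row_link (Λ := Λ) (a := a) i T p fun l hl => hrow (i + l) (by omega) (by omega)
  have r2 := row_link (Λ := Λ) (a := a) i' T p' fun l hl => hrow (i' + l) (by omega) (by omega)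
  have e1 : j + (n : ℤ) = T := by omega
  have e2 : j' + (n' : ℤ) = T := by omega
  have e3 : i + (p : ℤ) = max i i' := by omega
  have e4 : i' + (p' : ℤ) = max i i' := by omega
  rw [e1] at c1
  rw [e2] at c2
  rw [e3] at r1
  rw [e4] at r2
  refine ⟨fun H H' hH hH' => ?_, fun H hH => ?_⟩
  · have a1 := c1.1 H H' hH hH'
    have a2 := c2.1 H H' hH hH'
    have a3 := r1.1 H H' hH hH'
    have a4 := r2.1 H H' hH hH'
    linear_combination a1 - a2 + a3 - a4
  · have a1 := c1.2 H hH
    have a2 := c2.2 H hH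
    have a3 := r1.2 H hH
    have a4 := r2.2 H hH
    have hsplit : H ![i', j'] - H ![i, j] = (H ![i, max j j' + 1] - H ![i, j]) -
        (H ![i', max j j' + 1] - H ![i', j']) + (H ![max i i', max j j' + 1] - H ![i, max j j' + 1]) -
        (H ![max i i', max j j' + 1] - H ![i', max j j' + 1]) := by ring
    have hnr : (n : ℝ) ≤ |(j' : ℝ) - j| + 1 := by
      have : (n : ℤ) ≤ |j' - j| + 1 := by
        rw [hnz, hT]
        rcases le_total j j' with h | h
        · rw [max_eq_right h, abs_of_nonneg (by omega)]; omega
        · rw [max_eq_left h, abs_of_nonpos (by omega)]; omega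
      have h2 : ((n : ℤ) : ℝ) ≤ ((|j' - j| + 1 : ℤ) : ℝ) := by exact_mod_cast this
      push_cast at h2
      exact h2
    have hnr' : (n' : ℝ) ≤ |(j' : ℝ) - j| + 1 := by
      have : (n' : ℤ) ≤ |j' - j| + 1 := by
        rw [hnz', hT]
        rcases le_total j j' with h | h
        · rw [max_eq_right h, abs_of_nonneg (by omega)]; omega
        · rw [max_eq_left h, abs_of_nonpos (by omega)]; omega
      have h2 : ((n' : ℤ) : ℝ) ≤ ((|j' - j| + 1 : ℤ) : ℝ) := by exact_mod_cast this
      push_cast at h2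
      exact h2
    have hpr : (p : ℝ) + p' = |(i' : ℝ) - i| := by
      have : (p : ℤ) + p' = |i' - i| := by
        rw [hpz, hpz']
        rcases le_total i i' with h | h
        · rw [max_eq_right h, abs_of_nonneg (by omega)]; omega
        · rw [max_eq_left h, abs_of_nonpos (by omega)]; omega
      have h2 : ((p : ℤ) : ℝ) + ((p' : ℤ) : ℝ) = ((|i' - i| : ℤ) : ℝ) := by exact_mod_cast this
      push_cast at h2
      exact h2
    rw [hsplit]
    calc _ ≤ ‖H ![i, max j j' + 1] - H ![i, j]‖ + ‖H ![i', max j j' + 1] - H ![i', j']‖ +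
          ‖H ![max i i', max j j' + 1] - H ![i, max j j' + 1]‖ +
          ‖H ![max i i', max j j' + 1] - H ![i', max j j' + 1]‖ := by
          refine (norm_sub_le _ _).trans (add_le_add ((norm_add_le _ _).trans
            (add_le_add (norm_sub_le _ _) le_rfl)) le_rfl)
      _ ≤ n * B + n' * B + p * B + p' * B := by gcongr
      _ = (p + p' + (n + n')) * B := by ring
      _ ≤ (|(i' : ℝ) - i| + (2 * |(j' : ℝ) - j| + 2)) * B := by
          rw [hpr]
          refine mul_le_mul_of_nonneg_right ?_ hB
          linarith
      _ = _ := by push_cast; ring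

/-- **Registered piece `developingMapsCompact_boxLink`** of stub `stub_developingMapsCompact` (crux
stmt-CriticalPhenomena-14004, line `pick-half-plane`): the box link in registry form (one `∀`-term;
see `box_link`). [folklore] -/
theorem developingMapsCompact_boxLink : ∀ (Λ : Finset HexVertex) (a : Sym2 HexVertex) (i j i' j' : ℤ) (B : ℝ), 0 ≤ B → (∀ k l : ℤ, (k = i ∨ k = i') → min j j' ≤ l → l ≤ max j j' → upFace k l ∈ Λ ∧ ‖hexParafermionicObservable Λ a hexCriticalFugacity (5 / 8) s(upFace k l, ((![k - 1, l], 1) : HexVertex))‖ ≤ B) → (∀ k : ℤ, min i i' ≤ k → k < max i i' → upFace k (max j j' + 1) ∈ Λ ∧ ‖hexParafermionicObservable Λ a hexCriticalFugacity (5 / 8) (floorEdge k (max j j' + 1))‖ ≤ B) → (∀ H H' : Site 2 → ℂ, IsPotential Λ a H → IsPotential Λ a H' → H ![i', j'] - H ![i, j] = H' ![i', j'] - H' ![i, j]) ∧ (∀ H : Site 2 → ℂ, IsPotential Λ a H → ‖H ![i', j'] - H ![i, j]‖ ≤ (|i' - i| + 2 * |j' - j| + 2) * B) :=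
  fun _ _ i j i' j' _ hB hcol hrow => box_link i j i' j' hB hcol hrow

end Summit.CriticalPhenomena.SAWScalingLimit.Theorems.PickHalfPlane.DevelopingMaps

end
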